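import Summits.KontsevichZagierPeriods.KontsevichZagierPeriods.Theorems.GammaHodgeSector.Negative.Canonical

/-!
# `GammaHodgeSector` (stmt-KontsevichZagierPeriods-3742), line `InstanceSixtySix` —
stub `stub_shapeDas33`

Shape bookkeeping for the level-33 "deep" quadratic Beta pair `DasDeepThirtyThree`
(`B(1/33,1/33)·B(2/33,22/33) = c·B(1/33,3/33)·B(2/33,14/33)` as a KZ-equivalence of pinned
integral representations): the VERBATIM hypotheses on `r, r'` (cube domain `(0,1)²`, explicit
integrands with exponents `−32/33, −32/33, −31/33, −11/33` resp. `c · (−32/33, −30/33, −31/33,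
−19/33)`) are converted into the crux's pinned vocabulary `IsCubeBetaRep` / `IsBallCubeRep`
(with `k = 0`, `N = N' = 2`, `x = x' = (1/33, 2/33)`, `y = (1/33, 22/33)`, `y' = (3/33, 14/33)`),
and the pinned-vocabulary instance `h` is applied.
-/

noncomputable section

open MeasureTheory Set
open scoped BigOperators

namespace Summit.KontsevichZagierPeriods.GammaHodgeSectorRaise66

open Literature.NumberTheory.Transcendental
open Literature.NumberTheory.Transcendental.KZ
open Summit.KontsevichZagierPeriods.GammaHodgeSectorNegative

/-- **Shape**: the verbatim `DasDeepThirtyThree` from the pinned-vocabulary instance. The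
hypotheses `hd, hi` say exactly `IsCubeBetaRep (1/33,2/33) (1/33,22/33) r` and `hd', hi'` say
exactly `IsBallCubeRep 0 (1/33,2/33) (3/33,14/33) c r'` (empty ball factor, `0! = 1`), since
`1/33 − 1 = −32/33`, `2/33 − 1 = −31/33`, `22/33 − 1 = −11/33`, `3/33 − 1 = −30/33`,
`14/33 − 1 = −19/33`. [folklore] -/
theorem stub_shapeDas33
    (h : ∀ (c : ℝ), IsAlgebraic ℚ c → ∀ (r : IntegralRep 2) (r' : IntegralRep (2 * 0 + 2)),
      IsCubeBetaRep (![1/33, 2/33] : Fin 2 → ℚ) (![1/33, 22/33]) r →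
      IsBallCubeRep 0 (![1/33, 2/33] : Fin 2 → ℚ) (![3/33, 14/33]) c r' →
      r.value = r'.value → Equivalent r r')
    (c : ℝ) (hc : IsAlgebraic ℚ c) (r r' : IntegralRep 2)
    (hd : r.domain = {x | ∀ i, x i ∈ Set.Ioo (0:ℝ) 1})
    (hi : Set.EqOn r.integrand (fun x => (x 0) ^ (-(32:ℝ)/33) * (1 - x 0) ^ (-(32:ℝ)/33) *
      ((x 1) ^ (-(31:ℝ)/33) * (1 - x 1) ^ (-(11:ℝ)/33))) r.domain)
    (hd' : r'.domain = {x | ∀ i, x i ∈ Set.Ioo (0:ℝ) 1})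
    (hi' : Set.EqOn r'.integrand (fun x => c * ((x 0) ^ (-(32:ℝ)/33) * (1 - x 0) ^ (-(30:ℝ)/33) *
      ((x 1) ^ (-(31:ℝ)/33) * (1 - x 1) ^ (-(19:ℝ)/33)))) r'.domain)
    (hv : r.value = r'.value) : Equivalent r r' := by
  have hnat : ∀ l : Fin 2, (Fin.natAdd (2 * 0) l : Fin (2 * 0 + 2)) = l :=
    fun l => Fin.ext (by simp)
  refine h c hc r r' ⟨hd, ?_⟩ ⟨?_, ?_⟩ hv
  · intro t ht
    rw [hi ht]
    simp only [Fin.prod_univ_two, Matrix.cons_val_zero, Matrix.cons_val_one]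
    push_cast
    norm_num
  · rw [hd']
    ext z
    simp only [Set.mem_setOf_eq, hnat]
    simp
  · intro z hz
    rw [hi' hz]
    simp only [Fin.prod_univ_two, hnat, Nat.factorial_zero, Nat.cast_one, mul_one,
      Matrix.cons_val_zero, Matrix.cons_val_one]
    push_cast
    norm_num

end Summit.KontsevichZagierPeriods.GammaHodgeSectorRaise66
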